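import Summits.QuantumFields.BalabanUV.Beta.GAN24.TransportedWordReduction
import Summits.QuantumFields.BalabanUV.Beta.GAN24.VHWordsZeroLatticeStep
import Summits.QuantumFields.BalabanUV.Beta.GAN24.CombForcingSectorSplit
import Summits.QuantumFields.BalabanUV.Beta.GAN24.CombRespWordsZero

/-!
# `BalabanUV.Beta.GAN24.CombVHEWordsZeroStep` — binder row G-an2-4 ∕ (CONV-C), TRANSFER-III, the (III′) (C)-campaign's supplier `hB0`, **(24) AT THE COMB DATA, LEVELS `j + 1 ≥ 1`: THE
# LANDING BILL** (leaf-01 g85 `README-g85` «LOCATED» (24)_comb, caution on the (D)_comb tower): **THE `VH′_c ⊗ E′_{u′}` WORD AND ITS SWAP OVER TRANSPORTED TABLES VANISH AS SOON AS THE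
# BOND-RESUMMED EXIT-FACE CURRENT OF THE UNTRANSPORTED CUBIC SECTOR `c₀ • e3OfK Lc G_j M` IS DIVERGENCE-FREE (D) WITH ZERO CELL TOTALS (Z)** — for ANY local, block-covariant member `M` with
# parity-odd rows (at the comb data `M = 𝒯 S̃comb_j`, the transported folded comb member, an1's record): `TransportedWordReduction` with leaf-04 g68's every-level kill
# `DressedKernelOnCurrentStep.tsum_dressedStep_inr_mul_current`; (D)∕(Z) DISPLAYED — the (D)_comb ∕ (Z)_comb towers are NOT claimed
# (G-an2-4 CRUX TEAM (2), leaf prover `b2b-balaban-gan24-formalise-leaf-01`, gen 86; journal [LEAF01-G86-INTENT-2])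

NOT IN PRINT; OUR BOOKKEEPING ([folklore] BY NAME over `TransportedWordReduction` (gen 86; the level-`0` twin is `CombVHEWordsZero`), leaf-04's `VHWordsZeroLatticeStep` (`tsum_current_periodic`, `current_bounded`;
§1 here is its §1–§2 with the spine member `SrecAt j` replaced by a generic `M`), `DressedKernelOnCurrentStep`, an2's `ValueJetGeneric` (`e3OfK_apply`, `locStencil_e3OfK`, `e3OfK_translate`),
d1-leaf-05's `SpineRecursiveParity.trK_e3OfK_of_rows`, an2's `SymmetrisedStepJetsParity.trK_SrecOf`, leaf-02 g79's `SlotTransportParity.parityOdd_slotPsiS`, road-P2's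
`CombTransportParity.parityOdd_conj_psiKS`, leaf-01 g85 F6 `CombForcingSectorSplit` (`exists_locStencil_e3Sector_comb`, `transport_translate_comb`); 0 `def`, 0 cited fact, 0 `def … : Prop`, 0 sorry).
HONEST FRAMING (cell contract, verbatim): «discharging `BetaPertH` makes Bałaban's UV stability UNCONDITIONAL — a real constructive-QFT result; it is NOT the continuum limit and NOT
the Clay problem.»  HONEST DEPENDENCY (verbatim): «continuum YM on T⁴ ⇐ BetaPertH ∧ nine spine estimates (0/9 proved); BetaPertH ⇐ (D1) ∧ (D4) ∧ CAP+tail; G-an2-4 gates asym, D1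
and NE2/3/4.»

## What is proved (generic `d`, `[NeZero Lc]`, `1 ≤ Lc`, in-block kernel root `toSite rb`, `G_j = coDressKBmAt (toSite rb) Lc (KInvStep Lc j)`, `X̃♮_{j+1}`, `T := κ t ↦ c₀ • e3OfK Lc G_j M κ t`, all units)
* §1 the cubic sector of a generic member: `sector_inr_left ∕ _inr_right` (no multiplier legs), `exists_locStencil_sector` (`M` local), `sector_translate` (`M` block-covariant ⇒ `T` fine-covariant on
  the step-`(j+1)` lattice), `sector_parityOdd` ∕ **`sector_antisymm`** (`M` parity-odd), `vertexSector_translate`, **`sectorCurrent_periodic`** (the product-form current of `V^T_ν` is `Lc`-periodic).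
* §2 THE WORDS, ANY TRANSPORT ROOT `r ∈ box`, ANY `S′` WITHOUT ff BLOCK, (D)∕(Z) DISPLAYED on `t b z := Σ'_{(u′,w)} 𝟙f(w_β)·vertexOfK X̃♮_{j+1} Lc (unitS T) ν u′ z w (inl b)(inl β)`:
  **`tsum_transported_noFF_sector_word_eq_zero_of_divFree`** (direct), **`tsum_transported_sector_noFF_word_eq_zero_of_divFree`** (swap, the `α`-read current).
* §3 AT THE COMB DATA (`r = rb = ctrOff (d+1) Lc`, root `ctr (d+1) Lc`, an1's record `tabs = symTablesAn1S2 d Lc cΛt`, `M = 𝒯 (ScombOf tabs cE cVH cΛ j)`, `c₀ = cE·wE_{j+1}`, border `c • symVhSAt ρ_c`):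
  `exists_locStencil_transport_ScombOf`, `transport_ScombOf_translate`, `parityOdd_transport_ScombOf`, and **`comb_vhE_word_succ_eq_zero_of_divFree`** — F6 `dM_comb_succ_split`'s `V^VH′ ⊗ V^E′`
  direct word at level `j+1` vanishes per bond GIVEN (D)_comb ∧ (Z)_comb of the untransported comb E-sector current (displayed `hdiv`, `h0`).
WHAT THIS IS NOT: (D)_comb ∕ (Z)_comb are NOT proved (leaf-04's (D)-tower `ExitFaceCurrentDivFree` and (Z) `ExitFaceCurrentCellTotalsStep` are for the spine member `SrecAt j`, fine-covariant
and transport-free; the comb member carries `Ψ̂_S` below level `j+1`); NO value; NOT `hB0`; NEVER «G-an2-4 closed» as (CONV-C); NOT D1, NOT `BetaPertH`, NOT continuum, NOT Clay.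
2026-08-27; no existing file touched.
-/

noncomputable section

open Finset
open scoped BigOperators
open Literature.MathematicalPhysics.QuantumFieldTheory
open Literature.MathematicalPhysics.QuantumFieldTheory.Balaban1983to89
open Literature.MathematicalPhysics.QuantumFieldTheory.Balaban1983to89.Beta
open ExpKernelCalculus (Site MKer comp shiftK)
open AffineAveraging (box toSite unitVec)
open AveragingContoursRooted (ctr ctrOff ctrOff_mem_box)
open OneStepResolventKernel (Fib LocStencil)
open OneStepKernelFamily (KInvStep vertexOfK vertexOfK_translate)
open StepJetData (locStencil_smul)
open BalabanStepJetsSucc (mmRead_inr_left mmRead_inr_right wE)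
open Summit.QuantumFields.BalabanUV.Beta.TameKernelCalculus (trK trK_apply Loc)
open Summit.QuantumFields.BalabanUV.Beta.BorderedHessian (sgnK sgnK_apply sgnF_inl)
open Summit.QuantumFields.BalabanUV.Beta.AxialDressingRooted (coDressKBmAt decays_coDressKBmAt_KInvStep shiftK_coDressKBmAt_KInvStep)
open Summit.QuantumFields.BalabanUV.Beta.HessKerDressedUnits (unitK unitS unitS_apply)
open Summit.QuantumFields.BalabanUV.Beta.SpineRooted (e3OfK e3OfK_apply locStencil_e3OfK e3OfK_translate)
open Summit.QuantumFields.BalabanUV.Beta.SpineRecursiveParity (trK_e3OfK_of_rows parityOdd_smul)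
open Summit.QuantumFields.BalabanUV.Beta.BubbleParity (trK_coDressKBmAt_KInvStep spr_of_decays)
open Summit.QuantumFields.BalabanUV.Beta.SymmetrisedStepJetsParity (trK_SrecOf)
open Summit.QuantumFields.BalabanUV.Beta.SymAveragingHessianCounts (symVhSAt)
open Summit.QuantumFields.BalabanUV.Beta.SymTablesAn1FirstOrder (trK_symVhSAt trK_symHessFFAt)
open Summit.QuantumFields.BalabanUV.Beta.SymSecondOrderTablesAn1 (symTablesAn1S2)
open Summit.QuantumFields.BalabanUV.Beta.CombChartStepJets (GcombSh decays_GcombSh ScombOf ScombOf_eq locStencil_ScombOf ScombOf_translate)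
open Summit.QuantumFields.BalabanUV.Beta.CombChartWardSockets (trK_GcombSh)
open Summit.QuantumFields.BalabanUV.Beta.SymCorrectorKernel (psiKS spr_psiKS)
open Summit.QuantumFields.BalabanUV.Beta.SymCorrectorFace (slotPsiS)
open Summit.QuantumFields.BalabanUV.Beta.SymCorrectorSockets (locStencil_slotPsiS)
open Summit.QuantumFields.BalabanUV.Beta.GAN24.SlotTransportParity (parityOdd_slotPsiS)
open Summit.QuantumFields.BalabanUV.Beta.GAN24.CombTransportParity (parityOdd_conj_psiKS)
open Summit.QuantumFields.BalabanUV.Beta.GAN24.CombCubicStepTransport (locStencil_transportPsiS)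
open Summit.QuantumFields.BalabanUV.Beta.GAN24.EEWordReduced (shiftK_dressedStep)
open Summit.QuantumFields.BalabanUV.Beta.GAN24.ExchangeSlotResum (face_weight_periodic)
open Summit.QuantumFields.BalabanUV.Beta.GAN24.VHWordsZeroLatticeStep (tsum_current_periodic current_bounded)
open Summit.QuantumFields.BalabanUV.Beta.GAN24.DressedKernelOnCurrentStep (tsum_dressedStep_inr_mul_current)
open Summit.QuantumFields.BalabanUV.Beta.GAN24.CombTransportedBorder (pos_Lc locStencil_symVhS symVhS_inl_inl)
open Summit.QuantumFields.BalabanUV.Beta.GAN24.CombForcingSectorSplit (transport_translate_comb)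
open Summit.QuantumFields.BalabanUV.Beta.GAN24.TransportedWordReduction (tsum_transported_direct_word_eq_zero_of_current tsum_transported_swap_word_eq_zero_of_current)

namespace Summit.QuantumFields.BalabanUV.Beta.GAN24.CombVHEWordsZeroStep

variable {d : ℕ} {Lc : ℕ} [NeZero Lc] {rb : Fin (d + 1) → ℕ}

/-! ## §1 The cubic sector `T = c₀ • e3OfK Lc G_j M` of a generic member `M` -/

section Sector

variable {M : Fin (d + 1) → Site (d + 1) → MKer (d + 1) (Fib d)} {CM δM : ℝ}

/-- [folklore] The cubic sector of any member has no multiplier FIRST legs (`e3OfK = −mmRead(…)`). -/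
theorem sector_inr_left (c₀ : ℝ) (j : ℕ) (κ : Fin (d + 1)) (t x z : Site (d + 1)) (m : Fin (d + 1)) (b : Fib d) :
    (fun κ t => c₀ • e3OfK Lc (coDressKBmAt (toSite rb) Lc (KInvStep (d := d) Lc j)) M κ t) κ t x z (Sum.inr m) b = 0 := by
  simp only [Pi.smul_apply, smul_eq_mul, e3OfK_apply, mmRead_inr_left, neg_zero, mul_zero]

/-- [folklore] … and no multiplier SECOND legs. -/
theorem sector_inr_right (c₀ : ℝ) (j : ℕ) (κ : Fin (d + 1)) (t x z : Site (d + 1)) (a : Fib d) (m : Fin (d + 1)) :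
    (fun κ t => c₀ • e3OfK Lc (coDressKBmAt (toSite rb) Lc (KInvStep (d := d) Lc j)) M κ t) κ t x z a (Sum.inr m) = 0 := by
  simp only [Pi.smul_apply, smul_eq_mul, e3OfK_apply, mmRead_inr_right, neg_zero, mul_zero]

/-- [folklore] The cubic sector of a LOCAL member is a local stencil family (an2's `locStencil_e3OfK`). -/
theorem exists_locStencil_sector (hrb : rb ∈ box (d + 1) Lc) (c₀ : ℝ) (j : ℕ) (hM : LocStencil M CM δM) (hδM : 0 < δM) :
    ∃ C δ : ℝ, 0 < δ ∧ LocStencil (fun κ t => c₀ • e3OfK Lc (coDressKBmAt (toSite rb) Lc (KInvStep (d := d) Lc j)) M κ t) C δ := by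
  obtain ⟨C, δ, hδ, hV⟩ := locStencil_e3OfK (N := Lc) (Nat.one_le_iff_ne_zero.mpr (NeZero.ne Lc)) (decays_coDressKBmAt_KInvStep (d := d) hrb j) hM hδM
  exact ⟨_, δ, hδ, locStencil_smul c₀ hV⟩

/-- [folklore] The cubic sector of a BLOCK-COVARIANT member is fine-translation covariant on the step-`(j+1)` lattice (an2's `e3OfK_translate`). -/
theorem sector_translate (c₀ : ℝ) (j : ℕ) (hMt : ∀ (κ : Fin (d + 1)) (u t : Site (d + 1)), M κ (u + (Lc : ℤ) • t) = shiftK (-((Lc : ℤ) • t)) (M κ u))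
    (κ : Fin (d + 1)) (u v : Site (d + 1)) :
    (fun κ t => c₀ • e3OfK Lc (coDressKBmAt (toSite rb) Lc (KInvStep (d := d) Lc j)) M κ t) κ (u + v)
      = shiftK (-v) ((fun κ t => c₀ • e3OfK Lc (coDressKBmAt (toSite rb) Lc (KInvStep (d := d) Lc j)) M κ t) κ u) := by
  have h := e3OfK_translate (N := Lc) (K := coDressKBmAt (toSite rb) Lc (KInvStep (d := d) Lc j)) (shiftK_coDressKBmAt_KInvStep (d := d) (toSite rb) j) (S := M) hMt κ u v
  funext x z a b
  simp only [Pi.smul_apply, smul_eq_mul, shiftK, h]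

/-- [folklore] The cubic sector of a local PARITY-ODD member has parity-odd rows (d1-leaf-05's `trK_e3OfK_of_rows`). -/
theorem sector_parityOdd (hrb : rb ∈ box (d + 1) Lc) (c₀ : ℝ) (j : ℕ) (hM : LocStencil M CM δM) (hδM : 0 < δM) (hMp : ∀ κ u, trK (M κ u) = -sgnK (M κ u))
    (κ : Fin (d + 1)) (u : Site (d + 1)) :
    trK ((fun κ t => c₀ • e3OfK Lc (coDressKBmAt (toSite rb) Lc (KInvStep (d := d) Lc j)) M κ t) κ u)
      = -sgnK ((fun κ t => c₀ • e3OfK Lc (coDressKBmAt (toSite rb) Lc (KInvStep (d := d) Lc j)) M κ t) κ u) :=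
  parityOdd_smul _ (trK_e3OfK_of_rows (spr_of_decays (decays_coDressKBmAt_KInvStep hrb j)) (trK_coDressKBmAt_KInvStep hrb j) hM hδM hMp κ u)

/-- NOT IN PRINT; OUR BOOKKEEPING ([folklore]).  **THE CUBIC SECTOR OF A LOCAL PARITY-ODD MEMBER IS ANTISYMMETRIC UNDER THE EXCHANGE OF ITS TWO LEGS** (parity-odd ff block, zero elsewhere). -/
theorem sector_antisymm (hrb : rb ∈ box (d + 1) Lc) (c₀ : ℝ) (j : ℕ) (hM : LocStencil M CM δM) (hδM : 0 < δM) (hMp : ∀ κ u, trK (M κ u) = -sgnK (M κ u))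
    (κ : Fin (d + 1)) (u x z : Site (d + 1)) (a b : Fib d) :
    (fun κ t => c₀ • e3OfK Lc (coDressKBmAt (toSite rb) Lc (KInvStep (d := d) Lc j)) M κ t) κ u z x b a
      = -(fun κ t => c₀ • e3OfK Lc (coDressKBmAt (toSite rb) Lc (KInvStep (d := d) Lc j)) M κ t) κ u x z a b := by
  have hpar := sector_parityOdd (d := d) hrb c₀ j hM hδM hMp κ u
  have h := congrFun (congrFun (congrFun (congrFun hpar x) z) a) b
  simp only [trK_apply, Pi.neg_apply, sgnK_apply] at h
  show (c₀ • e3OfK Lc (coDressKBmAt (toSite rb) Lc (KInvStep (d := d) Lc j)) M κ u) z x b a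
    = -((c₀ • e3OfK Lc (coDressKBmAt (toSite rb) Lc (KInvStep (d := d) Lc j)) M κ u) x z a b)
  rcases a with a | m
  · rcases b with b | m'
    · rw [h, sgnF_inl, sgnF_inl]
      ring
    · simp only [Pi.smul_apply, smul_eq_mul, e3OfK_apply, mmRead_inr_left, mmRead_inr_right, neg_zero, mul_zero]
  · simp only [Pi.smul_apply, smul_eq_mul, e3OfK_apply, mmRead_inr_left, mmRead_inr_right, neg_zero, mul_zero]

/-- [folklore] The dressed vertex family over the unit-dressed cubic sector of a block-covariant member is block-covariant (`vertexOfK_translate` with `shiftK_dressedStep` and `sector_translate`). -/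
theorem vertexSector_translate (hLc : 1 ≤ Lc) (sf sm c₀ : ℝ) (j : ℕ)
    (hMt : ∀ (κ : Fin (d + 1)) (u t : Site (d + 1)), M κ (u + (Lc : ℤ) • t) = shiftK (-((Lc : ℤ) • t)) (M κ u)) (ν : Fin (d + 1)) (u s : Site (d + 1)) :
    vertexOfK (unitK sf sm (coDressKBmAt (toSite rb) Lc (KInvStep (d := d) Lc (j + 1)))) Lc
        (unitS sf sm (fun κ t => c₀ • e3OfK Lc (coDressKBmAt (toSite rb) Lc (KInvStep (d := d) Lc j)) M κ t)) ν (u + s)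
      = shiftK (-((Lc : ℤ) • s)) (vertexOfK (unitK sf sm (coDressKBmAt (toSite rb) Lc (KInvStep (d := d) Lc (j + 1)))) Lc
        (unitS sf sm (fun κ t => c₀ • e3OfK Lc (coDressKBmAt (toSite rb) Lc (KInvStep (d := d) Lc j)) M κ t)) ν u) := by
  refine vertexOfK_translate (N := Lc) (fun t => shiftK_dressedStep (r := rb) hLc sf sm (j + 1) t) (fun κ' u' v => ?_) ν u s
  funext x z a b
  have h := congrFun (congrFun (congrFun (congrFun (sector_translate (rb := rb) (d := d) c₀ j hMt κ' u' v) x) z) a) b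
  simp only [shiftK] at h ⊢
  simp only [unitS_apply, h]

/-- NOT IN PRINT; OUR BOOKKEEPING ([folklore]).  **THE PRODUCT-FORM CURRENT OF THE CUBIC-SECTOR VERTEX IS `Lc`-PERIODIC IN ITS SITE** (block-covariant member; any face direction `γ`, any legs). -/
theorem sectorCurrent_periodic (hLc : 1 ≤ Lc) (sf sm c₀ : ℝ) (j : ℕ)
    (hMt : ∀ (κ : Fin (d + 1)) (u t : Site (d + 1)), M κ (u + (Lc : ℤ) • t) = shiftK (-((Lc : ℤ) • t)) (M κ u)) (ν γ : Fin (d + 1)) (f g : Fib d) (z s : Site (d + 1)) :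
    ∑' uw : Site (d + 1) × Site (d + 1), (if uw.2 γ % (Lc : ℤ) = (Lc : ℤ) - 1 then (1 : ℝ) else 0) *
        vertexOfK (unitK sf sm (coDressKBmAt (toSite rb) Lc (KInvStep (d := d) Lc (j + 1)))) Lc
          (unitS sf sm (fun κ t => c₀ • e3OfK Lc (coDressKBmAt (toSite rb) Lc (KInvStep (d := d) Lc j)) M κ t)) ν uw.1 (z + (Lc : ℤ) • s) uw.2 f g
      = ∑' uw : Site (d + 1) × Site (d + 1), (if uw.2 γ % (Lc : ℤ) = (Lc : ℤ) - 1 then (1 : ℝ) else 0) *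
        vertexOfK (unitK sf sm (coDressKBmAt (toSite rb) Lc (KInvStep (d := d) Lc (j + 1)))) Lc
          (unitS sf sm (fun κ t => c₀ • e3OfK Lc (coDressKBmAt (toSite rb) Lc (KInvStep (d := d) Lc j)) M κ t)) ν uw.1 z uw.2 f g :=
  tsum_current_periodic (Lc := Lc) (R := vertexOfK (unitK sf sm (coDressKBmAt (toSite rb) Lc (KInvStep (d := d) Lc (j + 1)))) Lc
      (unitS sf sm (fun κ t => c₀ • e3OfK Lc (coDressKBmAt (toSite rb) Lc (KInvStep (d := d) Lc j)) M κ t)) ν)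
    (fun u s' => vertexSector_translate (rb := rb) hLc sf sm c₀ j hMt ν u s')
    (ρ := fun w : Site (d + 1) => if w γ % (Lc : ℤ) = (Lc : ℤ) - 1 then (1 : ℝ) else 0) (fun w s' => face_weight_periodic Lc γ w s') f g z s

end Sector

/-! ## §2 Level `j+1`: the words over a transported border and the transported cubic sector, (D)∕(Z) displayed -/

section Words

variable {r : Fin (d + 1) → ℕ} {S' M : Fin (d + 1) → Site (d + 1) → MKer (d + 1) (Fib d)} {Cs δs CM δM : ℝ} {μ ν α β : Fin (d + 1)}

/-- NOT IN PRINT; OUR BOOKKEEPING ([folklore]; (24) AT THE COMB DATA, LEVEL `j+1`, THE DIRECT WORD, (D)∕(Z) DISPLAYED).  For ANY transport root `r ∈ box`, in-block kernel root `toSite rb`,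
`1 ≤ Lc`, all units, any scalar `c₀`, any axes, any cell bond `c`, ANY local `S′` with zero ff block, ANY local block-covariant member `M`: IF the product-form current
`t b z := Σ'_{(u′,w)} 𝟙f(w_β)·vertexOfK X̃♮_{j+1} Lc (unitS (c₀ • e3OfK Lc G_j M)) ν u′ z w (inl b)(inl β)` of the UNTRANSPORTED cubic sector is divergence-free (`hdiv`) with zero cell totals (`h0`), THEN
`Σ'_{u′} Σ'_{(y,w)} 𝟙f(y_α)𝟙f(w_β)·((vertexOfK X̃♮_{j+1} Lc (unitS (𝒯S′)) μ c ∘ X̃♮_{j+1}) ∘ vertexOfK X̃♮_{j+1} Lc (unitS (𝒯(c₀ • e3OfK Lc G_j M))) ν u′) y w (inl α)(inl β) = 0`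
— `TransportedWordReduction.tsum_transported_direct_word_eq_zero_of_current` with §1 (periodicity, hence boundedness) and leaf-04 g68's every-level kill
`DressedKernelOnCurrentStep.tsum_dressedStep_inr_mul_current`. -/
theorem tsum_transported_noFF_sector_word_eq_zero_of_divFree (hLc : 1 ≤ Lc) (hrb : rb ∈ box (d + 1) Lc) (hr : r ∈ box (d + 1) Lc) (sf sm c₀ : ℝ) (j : ℕ)
    (hS : LocStencil S' Cs δs) (hδs : 0 < δs) (hSff : ∀ (κ' : Fin (d + 1)) (t x z : Site (d + 1)) (α' a : Fin (d + 1)), S' κ' t x z (Sum.inl α') (Sum.inl a) = 0)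
    (hM : LocStencil M CM δM) (hδM : 0 < δM) (hMt : ∀ (κ : Fin (d + 1)) (u t : Site (d + 1)), M κ (u + (Lc : ℤ) • t) = shiftK (-((Lc : ℤ) • t)) (M κ u)) (c : Site (d + 1))
    (hdiv : ∀ p : Site (d + 1), ∑ b : Fin (d + 1),
      ((∑' uw : Site (d + 1) × Site (d + 1), (if uw.2 β % (Lc : ℤ) = (Lc : ℤ) - 1 then (1 : ℝ) else 0) *
        vertexOfK (unitK sf sm (coDressKBmAt (toSite rb) Lc (KInvStep (d := d) Lc (j + 1)))) Lc
          (unitS sf sm (fun κ t => c₀ • e3OfK Lc (coDressKBmAt (toSite rb) Lc (KInvStep (d := d) Lc j)) M κ t)) ν uw.1 p uw.2 (Sum.inl b) (Sum.inl β)) -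
       (∑' uw : Site (d + 1) × Site (d + 1), (if uw.2 β % (Lc : ℤ) = (Lc : ℤ) - 1 then (1 : ℝ) else 0) *
        vertexOfK (unitK sf sm (coDressKBmAt (toSite rb) Lc (KInvStep (d := d) Lc (j + 1)))) Lc
          (unitS sf sm (fun κ t => c₀ • e3OfK Lc (coDressKBmAt (toSite rb) Lc (KInvStep (d := d) Lc j)) M κ t)) ν uw.1 (p - unitVec b) uw.2 (Sum.inl b) (Sum.inl β))) = 0)
    (h0 : ∀ b : Fin (d + 1), ∑ r' ∈ box (d + 1) Lc, ∑' uw : Site (d + 1) × Site (d + 1), (if uw.2 β % (Lc : ℤ) = (Lc : ℤ) - 1 then (1 : ℝ) else 0) *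
        vertexOfK (unitK sf sm (coDressKBmAt (toSite rb) Lc (KInvStep (d := d) Lc (j + 1)))) Lc
          (unitS sf sm (fun κ t => c₀ • e3OfK Lc (coDressKBmAt (toSite rb) Lc (KInvStep (d := d) Lc j)) M κ t)) ν uw.1 (toSite r') uw.2 (Sum.inl b) (Sum.inl β) = 0) :
    ∑' u' : Site (d + 1), ∑' yw : Site (d + 1) × Site (d + 1), (if yw.1 α % (Lc : ℤ) = (Lc : ℤ) - 1 then (1 : ℝ) else 0) * (if yw.2 β % (Lc : ℤ) = (Lc : ℤ) - 1 then (1 : ℝ) else 0) *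
        comp (comp (vertexOfK (unitK sf sm (coDressKBmAt (toSite rb) Lc (KInvStep (d := d) Lc (j + 1)))) Lc
            (unitS sf sm (fun κ u => comp (comp (trK (psiKS r Lc)) (slotPsiS r Lc S' κ u)) (psiKS r Lc))) μ c)
          (unitK sf sm (coDressKBmAt (toSite rb) Lc (KInvStep (d := d) Lc (j + 1)))))
          (vertexOfK (unitK sf sm (coDressKBmAt (toSite rb) Lc (KInvStep (d := d) Lc (j + 1)))) Lc
            (unitS sf sm (fun κ u => comp (comp (trK (psiKS r Lc)) (slotPsiS r Lc
              (fun κ t => c₀ • e3OfK Lc (coDressKBmAt (toSite rb) Lc (KInvStep (d := d) Lc j)) M κ t) κ u)) (psiKS r Lc))) ν u')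
          yw.1 yw.2 (Sum.inl α) (Sum.inl β) = 0 := by
  set t : Fin (d + 1) → Site (d + 1) → ℝ := fun b z => ∑' uw : Site (d + 1) × Site (d + 1), (if uw.2 β % (Lc : ℤ) = (Lc : ℤ) - 1 then (1 : ℝ) else 0) *
    vertexOfK (unitK sf sm (coDressKBmAt (toSite rb) Lc (KInvStep (d := d) Lc (j + 1)))) Lc
      (unitS sf sm (fun κ t => c₀ • e3OfK Lc (coDressKBmAt (toSite rb) Lc (KInvStep (d := d) Lc j)) M κ t)) ν uw.1 z uw.2 (Sum.inl b) (Sum.inl β) with ht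
  have hper : ∀ (b : Fin (d + 1)) (z s : Site (d + 1)), t b (z + (Lc : ℤ) • s) = t b z := fun b z s => by
    simp only [ht]
    exact sectorCurrent_periodic (rb := rb) hLc sf sm c₀ j hMt ν β (Sum.inl b) (Sum.inl β) z s
  have hdiv' : ∀ p : Site (d + 1), ∑ b : Fin (d + 1), (t b p - t b (p - unitVec b)) = 0 := fun p => by simp only [ht]; exact hdiv p
  have h0' : ∀ b : Fin (d + 1), ∑ r' ∈ box (d + 1) Lc, t b (toSite r') = 0 := fun b => by simp only [ht]; exact h0 b
  obtain ⟨CT, δT, hδT, hT⟩ := exists_locStencil_sector (d := d) hrb c₀ j hM hδM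
  exact tsum_transported_direct_word_eq_zero_of_current hLc hrb hr sf sm (j + 1) hS hδs hSff hT hδT
    (fun κ' t' x z m => sector_inr_left (rb := rb) c₀ j κ' t' x z m (Sum.inl β)) c (t := t) (fun b z => by simp only [ht])
    (fun b z => current_bounded (Lc := Lc) hper b z) hper
    (fun y₁ m => tsum_dressedStep_inr_mul_current hLc hrb sf sm (j + 1) (fun l y s => hper l y s) hdiv' h0' y₁ m)

/-- NOT IN PRINT; OUR BOOKKEEPING ([folklore]; (24) AT THE COMB DATA, LEVEL `j+1`, THE SWAP WORD, (D)∕(Z) DISPLAYED on the `α`-read current, `M` also parity-odd).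
`Σ'_{u′} Σ'_{(y,w)} 𝟙f(y_α)𝟙f(w_β)·((vertexOfK X̃♮_{j+1} Lc (unitS (𝒯(c₀ • e3OfK Lc G_j M))) ν u′ ∘ X̃♮_{j+1}) ∘ vertexOfK X̃♮_{j+1} Lc (unitS (𝒯S′)) μ c) y w (inl α)(inl β) = 0`. -/
theorem tsum_transported_sector_noFF_word_eq_zero_of_divFree (hLc : 1 ≤ Lc) (hrb : rb ∈ box (d + 1) Lc) (hr : r ∈ box (d + 1) Lc) (sf sm c₀ : ℝ) (j : ℕ)
    (hS : LocStencil S' Cs δs) (hδs : 0 < δs) (hSff : ∀ (κ' : Fin (d + 1)) (t x z : Site (d + 1)) (α' a : Fin (d + 1)), S' κ' t x z (Sum.inl α') (Sum.inl a) = 0)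
    (hM : LocStencil M CM δM) (hδM : 0 < δM) (hMt : ∀ (κ : Fin (d + 1)) (u t : Site (d + 1)), M κ (u + (Lc : ℤ) • t) = shiftK (-((Lc : ℤ) • t)) (M κ u))
    (hMp : ∀ κ u, trK (M κ u) = -sgnK (M κ u)) (c : Site (d + 1))
    (hdiv' : ∀ p : Site (d + 1), ∑ b : Fin (d + 1),
      ((∑' uy : Site (d + 1) × Site (d + 1), (if uy.2 α % (Lc : ℤ) = (Lc : ℤ) - 1 then (1 : ℝ) else 0) *
        vertexOfK (unitK sf sm (coDressKBmAt (toSite rb) Lc (KInvStep (d := d) Lc (j + 1)))) Lc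
          (unitS sf sm (fun κ t => c₀ • e3OfK Lc (coDressKBmAt (toSite rb) Lc (KInvStep (d := d) Lc j)) M κ t)) ν uy.1 p uy.2 (Sum.inl b) (Sum.inl α)) -
       (∑' uy : Site (d + 1) × Site (d + 1), (if uy.2 α % (Lc : ℤ) = (Lc : ℤ) - 1 then (1 : ℝ) else 0) *
        vertexOfK (unitK sf sm (coDressKBmAt (toSite rb) Lc (KInvStep (d := d) Lc (j + 1)))) Lc
          (unitS sf sm (fun κ t => c₀ • e3OfK Lc (coDressKBmAt (toSite rb) Lc (KInvStep (d := d) Lc j)) M κ t)) ν uy.1 (p - unitVec b) uy.2 (Sum.inl b) (Sum.inl α))) = 0)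
    (h0' : ∀ b : Fin (d + 1), ∑ r' ∈ box (d + 1) Lc, ∑' uy : Site (d + 1) × Site (d + 1), (if uy.2 α % (Lc : ℤ) = (Lc : ℤ) - 1 then (1 : ℝ) else 0) *
        vertexOfK (unitK sf sm (coDressKBmAt (toSite rb) Lc (KInvStep (d := d) Lc (j + 1)))) Lc
          (unitS sf sm (fun κ t => c₀ • e3OfK Lc (coDressKBmAt (toSite rb) Lc (KInvStep (d := d) Lc j)) M κ t)) ν uy.1 (toSite r') uy.2 (Sum.inl b) (Sum.inl α) = 0) :
    ∑' u' : Site (d + 1), ∑' yw : Site (d + 1) × Site (d + 1), (if yw.1 α % (Lc : ℤ) = (Lc : ℤ) - 1 then (1 : ℝ) else 0) * (if yw.2 β % (Lc : ℤ) = (Lc : ℤ) - 1 then (1 : ℝ) else 0) *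
        comp (comp (vertexOfK (unitK sf sm (coDressKBmAt (toSite rb) Lc (KInvStep (d := d) Lc (j + 1)))) Lc
            (unitS sf sm (fun κ u => comp (comp (trK (psiKS r Lc)) (slotPsiS r Lc
              (fun κ t => c₀ • e3OfK Lc (coDressKBmAt (toSite rb) Lc (KInvStep (d := d) Lc j)) M κ t) κ u)) (psiKS r Lc))) ν u')
          (unitK sf sm (coDressKBmAt (toSite rb) Lc (KInvStep (d := d) Lc (j + 1)))))
          (vertexOfK (unitK sf sm (coDressKBmAt (toSite rb) Lc (KInvStep (d := d) Lc (j + 1)))) Lc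
            (unitS sf sm (fun κ u => comp (comp (trK (psiKS r Lc)) (slotPsiS r Lc S' κ u)) (psiKS r Lc))) μ c)
          yw.1 yw.2 (Sum.inl α) (Sum.inl β) = 0 := by
  set t' : Fin (d + 1) → Site (d + 1) → ℝ := fun b z => ∑' uy : Site (d + 1) × Site (d + 1), (if uy.2 α % (Lc : ℤ) = (Lc : ℤ) - 1 then (1 : ℝ) else 0) *
    vertexOfK (unitK sf sm (coDressKBmAt (toSite rb) Lc (KInvStep (d := d) Lc (j + 1)))) Lc
      (unitS sf sm (fun κ t => c₀ • e3OfK Lc (coDressKBmAt (toSite rb) Lc (KInvStep (d := d) Lc j)) M κ t)) ν uy.1 z uy.2 (Sum.inl b) (Sum.inl α) with ht'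
  have hper : ∀ (b : Fin (d + 1)) (z s : Site (d + 1)), t' b (z + (Lc : ℤ) • s) = t' b z := fun b z s => by
    simp only [ht']
    exact sectorCurrent_periodic (rb := rb) hLc sf sm c₀ j hMt ν α (Sum.inl b) (Sum.inl α) z s
  have hdiv'' : ∀ p : Site (d + 1), ∑ b : Fin (d + 1), (t' b p - t' b (p - unitVec b)) = 0 := fun p => by simp only [ht']; exact hdiv' p
  have h0'' : ∀ b : Fin (d + 1), ∑ r' ∈ box (d + 1) Lc, t' b (toSite r') = 0 := fun b => by simp only [ht']; exact h0' b
  obtain ⟨CT, δT, hδT, hT⟩ := exists_locStencil_sector (d := d) hrb c₀ j hM hδM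
  exact tsum_transported_swap_word_eq_zero_of_current hLc hrb hr sf sm (j + 1) hS hδs hSff hT hδT
    (fun κ' u x z a b => sector_antisymm (rb := rb) hrb c₀ j hM hδM hMp κ' u x z a b)
    (fun κ' t'' x z m => sector_inr_left (rb := rb) c₀ j κ' t'' x z m (Sum.inl α)) c (t' := t') (fun b z => by simp only [ht'])
    (fun b z => current_bounded (Lc := Lc) hper b z) hper
    (fun y₁ m => tsum_dressedStep_inr_mul_current hLc hrb sf sm (j + 1) (fun l y s => hper l y s) hdiv'' h0'' y₁ m)

end Words

/-! ## §3 At the comb data: the transported folded comb member of an1's record -/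

section Comb

variable {μ ν α β : Fin (d + 1)}

/-- [folklore] `𝒯 S̃comb_j = Ψ̂_Sᵀ∘slotPsiS (ScombOf tabs cE cVH cΛ j)∘Ψ̂_S` is a local stencil family (an2's `locStencil_ScombOf` ⨾ road-P2 M.43 `locStencil_transportPsiS`). -/
theorem exists_locStencil_transport_ScombOf (cΛt cE cVH cΛ : ℝ) (j : ℕ) :
    ∃ Cs δs : ℝ, 0 < δs ∧ LocStencil (fun κ u => comp (comp (trK (psiKS (ctrOff (d + 1) Lc) Lc))
      (slotPsiS (ctrOff (d + 1) Lc) Lc (ScombOf (symTablesAn1S2 d Lc cΛt) cE cVH cΛ j) κ u)) (psiKS (ctrOff (d + 1) Lc) Lc)) Cs δs := by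
  obtain ⟨Cs, δs, hδs, hS⟩ := locStencil_ScombOf (symTablesAn1S2 d Lc cΛt) cE cVH cΛ j
  exact locStencil_transportPsiS (pos_Lc (Lc := Lc)) (ctrOff_mem_box (pos_Lc (Lc := Lc))) hS hδs

/-- [folklore] `𝒯 S̃comb_j` is block-covariant (an2's `ScombOf_translate` ⨾ leaf-01 g85 F6 `transport_translate_comb`). -/
theorem transport_ScombOf_translate (cΛt cE cVH cΛ : ℝ) (j : ℕ) (κ : Fin (d + 1)) (u t : Site (d + 1)) :
    (fun κ u => comp (comp (trK (psiKS (ctrOff (d + 1) Lc) Lc)) (slotPsiS (ctrOff (d + 1) Lc) Lc (ScombOf (symTablesAn1S2 d Lc cΛt) cE cVH cΛ j) κ u)) (psiKS (ctrOff (d + 1) Lc) Lc))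
        κ (u + (Lc : ℤ) • t)
      = shiftK (-((Lc : ℤ) • t)) ((fun κ u => comp (comp (trK (psiKS (ctrOff (d + 1) Lc) Lc)) (slotPsiS (ctrOff (d + 1) Lc) Lc (ScombOf (symTablesAn1S2 d Lc cΛt) cE cVH cΛ j) κ u))
        (psiKS (ctrOff (d + 1) Lc) Lc)) κ u) :=
  transport_translate_comb (Lc := Lc) (S := ScombOf (symTablesAn1S2 d Lc cΛt) cE cVH cΛ j) (fun κ u t => ScombOf_translate (symTablesAn1S2 d Lc cΛt) cE cVH cΛ j κ u t) κ u t

/-- [folklore] **`𝒯 S̃comb_j` HAS PARITY-ODD ROWS** at an1's record — an1's `trK_symVhSAt ∕ trK_symHessFFAt` through an2's slot-generic `trK_SrecOf` (at `G := GcombSh Lc`: `decays_GcombSh`,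
`trK_GcombSh`), kept by the slot transport (leaf-02 g79 `parityOdd_slotPsiS`) and by the leg congruence (road-P2 `parityOdd_conj_psiKS`); cf. leaf-01 g85 F4 `parityOdd_transportS` for the pure table. -/
theorem parityOdd_transport_ScombOf (cΛt cE cVH cΛ : ℝ) (j : ℕ) (κ : Fin (d + 1)) (u : Site (d + 1)) :
    trK ((fun κ u => comp (comp (trK (psiKS (ctrOff (d + 1) Lc) Lc)) (slotPsiS (ctrOff (d + 1) Lc) Lc (ScombOf (symTablesAn1S2 d Lc cΛt) cE cVH cΛ j) κ u)) (psiKS (ctrOff (d + 1) Lc) Lc)) κ u)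
      = -sgnK ((fun κ u => comp (comp (trK (psiKS (ctrOff (d + 1) Lc) Lc)) (slotPsiS (ctrOff (d + 1) Lc) Lc (ScombOf (symTablesAn1S2 d Lc cΛt) cE cVH cΛ j) κ u))
        (psiKS (ctrOff (d + 1) Lc) Lc)) κ u) := by
  have hp : ∀ (κ : Fin (d + 1)) (u : Site (d + 1)), trK (ScombOf (symTablesAn1S2 d Lc cΛt) cE cVH cΛ j κ u) = -sgnK (ScombOf (symTablesAn1S2 d Lc cΛt) cE cVH cΛ j κ u) := by
    intro κ u
    rw [ScombOf_eq]
    exact trK_SrecOf (symTablesAn1S2 d Lc cΛt).hV (symTablesAn1S2 d Lc cΛt).hH (decays_GcombSh (d := d) Lc) (fun j => trK_GcombSh (d := d) (Lc := Lc) j)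
      (fun κ u => trK_symVhSAt (ctr (d + 1) Lc) Lc κ u) (fun μ y => trK_symHessFFAt (ctr (d + 1) Lc) Lc μ y) cE cVH cΛ j κ u
  obtain ⟨Cs, δs, hδs, hS⟩ := locStencil_ScombOf (symTablesAn1S2 d Lc cΛt) cE cVH cΛ j
  have hT := locStencil_slotPsiS (d := d) (pos_Lc (Lc := Lc)) (ctrOff (d + 1) Lc) hS hδs.le
  have hX : Loc (slotPsiS (ctrOff (d + 1) Lc) Lc (ScombOf (symTablesAn1S2 d Lc cΛt) cE cVH cΛ j) κ u) := ⟨u, u, _, _, hδs, hT κ u⟩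
  exact parityOdd_conj_psiKS (spr_psiKS (pos_Lc (Lc := Lc)) (ctrOff_mem_box (pos_Lc (Lc := Lc)))) hX (parityOdd_slotPsiS (ctrOff (d + 1) Lc) Lc _ hp κ u)

/-- NOT IN PRINT; OUR BOOKKEEPING ([folklore]; (24)_comb AT LEVEL `j+1` MODULO (D)_comb ∧ (Z)_comb — F6 `CombForcingSectorSplit.dM_comb_succ_split`'s `V^VH′ ⊗ V^E′` direct word at an1's record).
At the comb root `ρ_c = ctr (d+1) Lc`, transport `𝒯 = Ψ̂_Sᵀ∘slotPsiS (ctrOff) Lc∘Ψ̂_S`, record `tabs = symTablesAn1S2 d Lc cΛt`, all units, pins `cE cVH cΛ`, any border weight `c` (`= cVH·wVH_{j+1}` in F6),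
every `j`, every cell bond `cb`, all axes: IF the product-form exit-face current of the UNTRANSPORTED comb E-sector `(cE·wE_{j+1}) • e3OfK Lc G_j (𝒯 S̃comb_j)` through `X̃_{j+1}` is divergence-free
(`hdiv` = (D)_comb) with zero cell totals (`h0` = (Z)_comb), THEN
`Σ'_{u′} FF[(vertexOfK X̃_{j+1} Lc (unitS (𝒯 S^VH_c)) μ cb ∘ X̃_{j+1}) ∘ vertexOfK X̃_{j+1} Lc (unitS (𝒯((cE·wE_{j+1}) • e3OfK Lc G_j (𝒯 S̃comb_j)))) ν u′] = 0` — §2 at `r = rb = ctrOff (d+1) Lc`, `M = 𝒯 S̃comb_j`. -/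
theorem comb_vhE_word_succ_eq_zero_of_divFree (sf sm cΛt cE cVH cΛ c : ℝ) (j : ℕ) (cb : Site (d + 1))
    (hdiv : ∀ p : Site (d + 1), ∑ b : Fin (d + 1),
      ((∑' uw : Site (d + 1) × Site (d + 1), (if uw.2 β % (Lc : ℤ) = (Lc : ℤ) - 1 then (1 : ℝ) else 0) *
        vertexOfK (unitK sf sm (coDressKBmAt (ctr (d + 1) Lc) Lc (KInvStep (d := d) Lc (j + 1)))) Lc
          (unitS sf sm (fun κ t => (cE * wE d Lc (j + 1)) • e3OfK Lc (coDressKBmAt (ctr (d + 1) Lc) Lc (KInvStep (d := d) Lc j))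
            (fun κ u => comp (comp (trK (psiKS (ctrOff (d + 1) Lc) Lc)) (slotPsiS (ctrOff (d + 1) Lc) Lc (ScombOf (symTablesAn1S2 d Lc cΛt) cE cVH cΛ j) κ u))
              (psiKS (ctrOff (d + 1) Lc) Lc)) κ t)) ν uw.1 p uw.2 (Sum.inl b) (Sum.inl β)) -
       (∑' uw : Site (d + 1) × Site (d + 1), (if uw.2 β % (Lc : ℤ) = (Lc : ℤ) - 1 then (1 : ℝ) else 0) *
        vertexOfK (unitK sf sm (coDressKBmAt (ctr (d + 1) Lc) Lc (KInvStep (d := d) Lc (j + 1)))) Lc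
          (unitS sf sm (fun κ t => (cE * wE d Lc (j + 1)) • e3OfK Lc (coDressKBmAt (ctr (d + 1) Lc) Lc (KInvStep (d := d) Lc j))
            (fun κ u => comp (comp (trK (psiKS (ctrOff (d + 1) Lc) Lc)) (slotPsiS (ctrOff (d + 1) Lc) Lc (ScombOf (symTablesAn1S2 d Lc cΛt) cE cVH cΛ j) κ u))
              (psiKS (ctrOff (d + 1) Lc) Lc)) κ t)) ν uw.1 (p - unitVec b) uw.2 (Sum.inl b) (Sum.inl β))) = 0)
    (h0 : ∀ b : Fin (d + 1), ∑ r' ∈ box (d + 1) Lc, ∑' uw : Site (d + 1) × Site (d + 1), (if uw.2 β % (Lc : ℤ) = (Lc : ℤ) - 1 then (1 : ℝ) else 0) *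
        vertexOfK (unitK sf sm (coDressKBmAt (ctr (d + 1) Lc) Lc (KInvStep (d := d) Lc (j + 1)))) Lc
          (unitS sf sm (fun κ t => (cE * wE d Lc (j + 1)) • e3OfK Lc (coDressKBmAt (ctr (d + 1) Lc) Lc (KInvStep (d := d) Lc j))
            (fun κ u => comp (comp (trK (psiKS (ctrOff (d + 1) Lc) Lc)) (slotPsiS (ctrOff (d + 1) Lc) Lc (ScombOf (symTablesAn1S2 d Lc cΛt) cE cVH cΛ j) κ u))
              (psiKS (ctrOff (d + 1) Lc) Lc)) κ t)) ν uw.1 (toSite r') uw.2 (Sum.inl b) (Sum.inl β) = 0) :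
    ∑' u' : Site (d + 1), ∑' yw : Site (d + 1) × Site (d + 1), (if yw.1 α % (Lc : ℤ) = (Lc : ℤ) - 1 then (1 : ℝ) else 0) * (if yw.2 β % (Lc : ℤ) = (Lc : ℤ) - 1 then (1 : ℝ) else 0) *
        comp (comp (vertexOfK (unitK sf sm (coDressKBmAt (ctr (d + 1) Lc) Lc (KInvStep (d := d) Lc (j + 1)))) Lc
            (unitS sf sm (fun κ v => comp (comp (trK (psiKS (ctrOff (d + 1) Lc) Lc))
              (slotPsiS (ctrOff (d + 1) Lc) Lc (fun κ v => c • symVhSAt (ctr (d + 1) Lc) d Lc rfl κ v) κ v)) (psiKS (ctrOff (d + 1) Lc) Lc))) μ cb)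
          (unitK sf sm (coDressKBmAt (ctr (d + 1) Lc) Lc (KInvStep (d := d) Lc (j + 1)))))
          (vertexOfK (unitK sf sm (coDressKBmAt (ctr (d + 1) Lc) Lc (KInvStep (d := d) Lc (j + 1)))) Lc
            (unitS sf sm (fun κ u => comp (comp (trK (psiKS (ctrOff (d + 1) Lc) Lc)) (slotPsiS (ctrOff (d + 1) Lc) Lc
              (fun κ t => (cE * wE d Lc (j + 1)) • e3OfK Lc (coDressKBmAt (ctr (d + 1) Lc) Lc (KInvStep (d := d) Lc j))
                (fun κ u => comp (comp (trK (psiKS (ctrOff (d + 1) Lc) Lc)) (slotPsiS (ctrOff (d + 1) Lc) Lc (ScombOf (symTablesAn1S2 d Lc cΛt) cE cVH cΛ j) κ u))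
                  (psiKS (ctrOff (d + 1) Lc) Lc)) κ t) κ u)) (psiKS (ctrOff (d + 1) Lc) Lc))) ν u')
          yw.1 yw.2 (Sum.inl α) (Sum.inl β) = 0 := by
  have hLc : 1 ≤ Lc := Nat.one_le_iff_ne_zero.mpr (NeZero.ne Lc)
  obtain ⟨CM, δM, hδM, hM⟩ := exists_locStencil_transport_ScombOf (d := d) (Lc := Lc) cΛt cE cVH cΛ j
  exact tsum_transported_noFF_sector_word_eq_zero_of_divFree (μ := μ) (ν := ν) (α := α) (β := β) hLc (ctrOff_mem_box (pos_Lc (Lc := Lc))) (ctrOff_mem_box (pos_Lc (Lc := Lc))) sf sm (cE * wE d Lc (j + 1)) j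
    (locStencil_symVhS (Lc := Lc) c zero_le_one) one_pos (fun κ' t x z α' a => symVhS_inl_inl (Lc := Lc) c κ' t x z α' a) hM hδM
    (fun κ u t => transport_ScombOf_translate (d := d) (Lc := Lc) cΛt cE cVH cΛ j κ u t) cb hdiv h0

end Comb

end Summit.QuantumFields.BalabanUV.Beta.GAN24.CombVHEWordsZeroStep

end
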